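import Literature.Claims.NS.PinheiroQueiroz2025
import Mathlib.Analysis.Calculus.MeanValue
import HarnessLib

/-! C152 `PinheiroQueiroz2025` — SALVAGE (a) TRUE-column file (cell `ns-claims`, D-0090; filed by
ns-claims-salvage-p6 g3 from ns-claims-ref-4 g6's kernel file `RETYPE-ref4g6-charitable-smallStrict.lean`
sha16 66d2326573b30aa8 with the namespace moved under `Summit.…Theorems.PinheiroQueiroz2025Salvage` and the unproved
non-strict face `Step4_Majorant_small` + its bridge `smallStrict_of_small` left out — every decl below is
proved, standard axioms).
Referee charitable column IN THE KERNEL (ns-claims-ref-4 g6, at the FORMAL of 11:36:33Z): the ONE charitable re-typing of §6.5 p.7 l.22–32 is the SMALL-DATA face (ref-4 g5 v0.2,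
`Step4_Majorant_small`: the printed majorant bound only for `A·y(0) ≤ B ∧ A·√y(0) ≤ B`). Here its STRICT
sub-face (`A·√y(0) < B`, i.e. `y(0) < (B/A)²` strictly below the unstable equilibrium) is PROVED for every
`K`: below the equilibrium the printed inequality `y′ ≤ −By + Ay^{3/2}` forces `y ≤ y(0)` (one-sided
fencing, `image_le_of_deriv_right_lt_deriv_boundary`), and below `B/A` the printed majorant is `≥ y(0)`.
So the charitable face SURVIVES as a theorem — and is RESTRICTED to small data (it does not reach the
all-data composition `claim_of_steps`). The boundary case `A·√y(0) = B` is left out (it needs a Gronwall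
argument, not a fence). Nothing about NS is asserted; no locator is asserted. -/

set_option linter.dupNamespace false

noncomputable section

open Set Filter Topology

namespace Summit.NavierStokesRegularity.NavierStokesRegularity.Theorems.PinheiroQueiroz2025Salvage

open Literature.Claims.NS.PinheiroQueiroz2025

/-- The STRICT small-data face: `A·y(0) ≤ B` and `A·√y(0) < B` (strictly below the equilibrium). -/
def Step4_Majorant_smallStrict (K : Constants) : Prop :=
  ∀ ν : ℝ, 0 < ν → ∀ s : ℝ, 5 / 2 < s → ∀ (y : ℝ → ℝ) (T : ℝ), ContinuousOn y (Ico 0 T) →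
    (∀ t ∈ Ico 0 T, 0 ≤ y t) →
    (∀ t ∈ Ioo 0 T, DifferentiableAt ℝ y t ∧
      deriv y t ≤ -K.B ν s * y t + K.A ν s * (y t * Real.sqrt (y t))) →
    K.A ν s * y 0 ≤ K.B ν s → K.A ν s * Real.sqrt (y 0) < K.B ν s →
    ∀ t ∈ Ico 0 T, y t ≤ majorant (K.A ν s) (K.B ν s) (y 0) t

/-- Below the threshold `A·y₀ ≤ B` the printed majorant is at least `y₀` (real arithmetic; copy of
RETYPE-ref4g5-prep.lean). -/
theorem le_majorant_of_small {A B y₀ t : ℝ} (hA : 0 < A) (hB : 0 < B) (hy : 0 ≤ y₀) (ht : 0 ≤ t)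
    (hsm : A * y₀ ≤ B) : y₀ ≤ majorant A B y₀ t := by
  unfold majorant
  rcases eq_or_lt_of_le hy with hy0 | hy0
  · subst hy0; simp
  have hexp0 : 0 < Real.exp (-B * t) := Real.exp_pos _
  have hexp1 : Real.exp (-B * t) ≤ 1 := by
    rw [Real.exp_le_one_iff]; nlinarith
  have hden : (B - A * y₀) * Real.exp (-B * t) + A * y₀ ≤ B := by
    have : (B - A * y₀) * Real.exp (-B * t) ≤ B - A * y₀ :=
      mul_le_of_le_one_right (by linarith) hexp1
    linarith
  have hdenpos : 0 < (B - A * y₀) * Real.exp (-B * t) + A * y₀ := by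
    have : 0 ≤ (B - A * y₀) * Real.exp (-B * t) := mul_nonneg (by linarith) hexp0.le
    nlinarith
  rw [le_div_iff₀ hdenpos]
  nlinarith

/-- FENCE: a non-negative `y`, continuous on `[0,T)`, differentiable on `(0,T)` with the printed inequality
`y′ ≤ −By + Ay^{3/2}` there, that starts below a level `ε` with `A√ε < B` stays below `ε`. -/
theorem le_eps_of_riccati {A B : ℝ} {y : ℝ → ℝ} {T : ℝ}
    (hc : ContinuousOn y (Ico 0 T)) (hnn : ∀ t ∈ Ico 0 T, 0 ≤ y t)
    (hd : ∀ t ∈ Ioo 0 T, DifferentiableAt ℝ y t ∧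
      deriv y t ≤ -B * y t + A * (y t * Real.sqrt (y t)))
    {ε : ℝ} (hε0 : y 0 < ε) (hεB : A * Real.sqrt ε < B) :
    ∀ t ∈ Ico 0 T, y t ≤ ε := by
  intro t ht
  rcases eq_or_lt_of_le ht.1 with h0 | h0
  · rw [← h0]; exact hε0.le
  have hT : 0 < T := lt_of_le_of_lt ht.1 ht.2
  have hεpos : 0 < ε := lt_of_le_of_lt (hnn 0 ⟨le_rfl, hT⟩) hε0
  -- a point `s ∈ (0, t)` with `y s < ε`, by continuity at `0` from the right
  have hcont0 : ContinuousWithinAt y (Ico 0 T) 0 := hc 0 ⟨le_rfl, hT⟩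
  have h1 : ∀ᶠ x in 𝓝[Ico 0 T] (0 : ℝ), y x < ε := hcont0.eventually (eventually_lt_nhds hε0)
  have h2 : ∀ᶠ x in 𝓝[>] (0 : ℝ), y x < ε := by
    rw [← nhdsWithin_Ioo_eq_nhdsGT hT]
    exact h1.filter_mono (nhdsWithin_mono _ Ioo_subset_Ico_self)
  have h3 : ∀ᶠ x in 𝓝[>] (0 : ℝ), x ∈ Ioo 0 t := Ioo_mem_nhdsGT h0
  obtain ⟨s, hs_lt, hs_mem⟩ := (h2.and h3).exists
  -- fence on `[s, t]` against the constant level `ε`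
  have key := image_le_of_deriv_right_lt_deriv_boundary (f := y) (f' := deriv y) (a := s) (b := t)
    (B := fun _ => ε) (B' := fun _ => 0)
    (hc.mono fun x hx => ⟨hs_mem.1.le.trans hx.1, lt_of_le_of_lt hx.2 ht.2⟩)
    (fun x hx => (hd x ⟨lt_of_lt_of_le hs_mem.1 hx.1, lt_trans hx.2 ht.2⟩).1.hasDerivAt.hasDerivWithinAt)
    hs_lt.le (fun x => hasDerivAt_const x ε)
    (by
      intro x hx hxε
      have hdx := (hd x ⟨lt_of_lt_of_le hs_mem.1 hx.1, lt_trans hx.2 ht.2⟩).2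
      rw [hxε] at hdx
      have : -B * ε + A * (ε * Real.sqrt ε) < 0 := by
        nlinarith [mul_pos hεpos (sub_pos.2 hεB)]
      exact lt_of_le_of_lt hdx this)
  exact key ⟨hs_mem.2.le, le_rfl⟩

/-- Below the unstable equilibrium `(B/A)²` the printed inequality forces `y(t) ≤ y(0)` on `[0, T)`. -/
theorem le_init_of_riccati {A B : ℝ} (hA : 0 < A) (hB : 0 < B) {y : ℝ → ℝ} {T : ℝ}
    (hc : ContinuousOn y (Ico 0 T)) (hnn : ∀ t ∈ Ico 0 T, 0 ≤ y t)
    (hd : ∀ t ∈ Ioo 0 T, DifferentiableAt ℝ y t ∧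
      deriv y t ≤ -B * y t + A * (y t * Real.sqrt (y t)))
    (hsmall : A * Real.sqrt (y 0) < B) : ∀ t ∈ Ico 0 T, y t ≤ y 0 := by
  intro t ht
  by_contra hlt
  push Not at hlt
  have hT : 0 < T := lt_of_le_of_lt ht.1 ht.2
  have hy0 : 0 ≤ y 0 := hnn 0 ⟨le_rfl, hT⟩
  have hBA : 0 < B / A := div_pos hB hA
  have hsq : Real.sqrt (y 0) < B / A := by
    rw [lt_div_iff₀ hA, mul_comm]; exact hsmall
  have hy0sq : y 0 < (B / A) ^ 2 := (Real.sqrt_lt' hBA).1 hsq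
  set ε := min ((y 0 + y t) / 2) ((y 0 + (B / A) ^ 2) / 2) with hε
  have hε1 : y 0 < ε := lt_min (by linarith) (by linarith)
  have hε2 : ε < y t := (min_le_left _ _).trans_lt (by linarith)
  have hε3 : ε < (B / A) ^ 2 := (min_le_right _ _).trans_lt (by linarith)
  have hεB : A * Real.sqrt ε < B := by
    have : Real.sqrt ε < B / A := (Real.sqrt_lt' hBA).2 hε3
    rw [lt_div_iff₀ hA, mul_comm] at this; exact this
  exact absurd (le_eps_of_riccati hc hnn hd hε1 hεB t ht) (not_le.mpr hε2)

/-- **The strict small-data charitable face HOLDS for every `K`.** -/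
theorem step4_smallStrict_holds (K : Constants) : Step4_Majorant_smallStrict K := by
  intro ν hν s hs y T hc hnn hd h1 h2 t ht
  have hA := K.A_pos ν s hν hs
  have hB := K.B_pos ν s hν hs
  have hy0 : 0 ≤ y 0 := hnn 0 ⟨le_rfl, lt_of_le_of_lt ht.1 ht.2⟩
  calc y t ≤ y 0 := le_init_of_riccati hA hB hc hnn hd h2 t ht
    _ ≤ majorant (K.A ν s) (K.B ν s) (y 0) t := le_majorant_of_small hA hB hy0 ht.1 h1

end Summit.NavierStokesRegularity.NavierStokesRegularity.Theorems.PinheiroQueiroz2025Salvage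

end
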